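import Literature.Computability.QuantumComplexity.JonesInBQPProofs
import Literature.Computability.Cryptography.GateSetTransport
import HarnessLib

/-!
# `PromiseBQPOver` grows with the gate set; `PromiseBQP ⊆ PromiseBQPOver ajlGateSet`

Topic `Literature/Computability/QuantumComplexity`; sibling of `JonesInBQPProofs.lean` (which defines
the promise class `PromiseBQPOver G` over a gate set and the AJL gate set `ajlGateSet` = Clifford+`T`
together with the two controlled crossing gates at `k = 5`). The elementary half of gate-set
independence of `PromiseBQP` (Watrous 2009, §III.1–III.2; Bernstein–Vazirani 1997, §8): along an
embedding of gate sets `E : GateSetEmb G G'` (`Cryptography/GateSetTransport.lean`: relabelling of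
gate symbols preserving arities and matrices whose recoding of symbol numerals is an `FP` transducer)
every uniform oracle-free family over `G` becomes one over `G'` with the same acceptance
probabilities, so **`PromiseBQPOver G ⊆ PromiseBQPOver G'`** (`PromiseBQPOver_mono`). The instance
Clifford+`T` `↪ ajlGateSet` is the left summand `Sum.inl` of the alphabet
`AJLOp = CliffordTOp ⊕ Bool` (code `c ↦ 2c`, `GateSetEmb.ofDouble`), whence
**`PromiseBQP ⊆ PromiseBQPOver ajlGateSet`** and the reduction of the named fact
`ajl_mem_PromiseBQPOver_ajlGateSet` (AJL §3 in AJL's own finite gate set) to the named fact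
`ajl_jonesApproxProblem_mem_PromiseBQP` (`JonesInBQP.lean`: the same membership over Clifford+`T`,
Aharonov–Jones–Landau 2009, Thm. 1.2 with §3): a Clifford+`T` algorithm for `jonesApproxProblem`
is in particular an algorithm over the larger gate set.

## References

* J. Watrous, *Quantum computational complexity* (2009), §III.1 (robustness of `BQP` under the choice
  of gate set) and §III.2 [Watrous2009].
* E. Bernstein, U. Vazirani, *Quantum complexity theory*, SIAM J. Comput. 26 (1997), §8
  [BernsteinVazirani1997].
* D. Aharonov, V. Jones, Z. Landau, Algorithmica 55 (2009) = arXiv:quant-ph/0511096, §2.1 ("this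
  [hybrid] model can be simulated efficiently by the standard quantum computation model"), §3.3,
  Thm. 3.2 [AharonovJonesLandau2009].
-/

noncomputable section

namespace Literature.Computability.QuantumComplexity

open Cryptography

/-! ### Monotonicity of `PromiseBQPOver` along embeddings of gate sets -/

/-- **`PromiseBQPOver G ⊆ PromiseBQPOver G'` along an embedding of gate sets**: transport the
family (`GateSetEmb.mapFamily`); oracle-freeness, uniformity and acceptance probabilities are
preserved. [cite: Watrous2009, §III.1–III.2] [cite: BernsteinVazirani1997, §8] -/
theorem PromiseBQPOver_mono {G G' : QGateSet} [Encodable G.Op] [Encodable G'.Op] (E : GateSetEmb G G') :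
    PromiseBQPOver G ⊆ PromiseBQPOver G' := by
  rintro Q ⟨F, hF, hU, hyes, hno⟩
  refine ⟨E.mapFamily F, E.isOracleFree_mapFamily hF, E.isUniform_mapFamily hU, fun x hx => ?_, fun x hx => ?_⟩
  · rw [E.acceptProbOn_mapFamily]; exact hyes x hx
  · rw [E.acceptProbOn_mapFamily]; exact hno x hx

/-- **`PromiseBQP ⊆ PromiseBQPOver G'` for every gate set into which Clifford+`T` embeds.**
[cite: Watrous2009, §III.1–III.2] -/
theorem PromiseBQP_subset_PromiseBQPOver {G' : QGateSet} [Encodable G'.Op] (E : GateSetEmb cliffordT G') :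
    PromiseBQP ⊆ PromiseBQPOver G' := by
  rw [← PromiseBQPOver_cliffordT]; exact PromiseBQPOver_mono E

/-! ### Clifford+`T` inside the AJL gate set -/

/-- The code of a Clifford+`T` symbol inside the AJL alphabet `CliffordTOp ⊕ Bool` is doubled
(Mathlib's `Encodable` instance on a sum). [folklore] -/
theorem encode_inl_ajlGateSet (g : cliffordT.Op) :
    Encodable.encode (Sum.inl g : ajlGateSet.Op) = 2 * Encodable.encode g :=
  Encodable.encode_inl g

/-- **The embedding of Clifford+`T` into the AJL gate set**: the left summand of the alphabet
`AJLOp = CliffordTOp ⊕ Bool`; arities and matrices agree by the definition of `ajlGateSet`, and codes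
double under Mathlib's `Encodable` instance on a sum. [folklore] -/
def cliffordTEmbAjlGateSet : GateSetEmb cliffordT ajlGateSet :=
  GateSetEmb.ofDouble Sum.inl (fun _ => rfl) (fun _ => HEq.rfl) encode_inl_ajlGateSet

/-- The embedding acts as `Sum.inl` on symbols. [folklore] -/
@[simp] theorem cliffordTEmbAjlGateSet_ι (g : cliffordT.Op) : cliffordTEmbAjlGateSet.ι g = Sum.inl g := rfl

/-- **`PromiseBQP ⊆ PromiseBQPOver ajlGateSet`.** [cite: Watrous2009, §III.1–III.2] -/
theorem PromiseBQP_subset_PromiseBQPOver_ajlGateSet : PromiseBQP ⊆ PromiseBQPOver ajlGateSet :=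
  PromiseBQP_subset_PromiseBQPOver cliffordTEmbAjlGateSet

/-- **`BQP ⊆ BQPOver ajlGateSet`** (language classes). [cite: Watrous2009, §III.1] -/
theorem BQP_subset_BQPOver_ajlGateSet : BQP ⊆ BQPOver ajlGateSet :=
  cliffordTEmbAjlGateSet.BQPOver_subset

/-- **Reduction of `ajl_mem_PromiseBQPOver_ajlGateSet` to `ajl_jonesApproxProblem_mem_PromiseBQP`:**
a polynomial-time uniform Clifford+`T` family deciding `jonesApproxProblem` (AJL Thm. 1.2 with §3, as
a `PromiseBQP` membership) is, read in the larger alphabet, a uniform family over `ajlGateSet`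
deciding it. [cite: AharonovJonesLandau2009, Thm. 3.2 and §2.1] [cite: Watrous2009, §III.1–III.2] -/
theorem ajl_mem_PromiseBQPOver_ajlGateSet_of_mem_PromiseBQP (h : ajl_jonesApproxProblem_mem_PromiseBQP) :
    ajl_mem_PromiseBQPOver_ajlGateSet :=
  PromiseBQP_subset_PromiseBQPOver_ajlGateSet h

/-- Conversely to the assembly `ajl_jonesApproxProblem_mem_PromiseBQP_of_steps`: the two named facts
`ajl_mem_PromiseBQPOver_ajlGateSet` and `ajl_jonesApproxProblem_mem_PromiseBQP` are equivalent given
gate-set independence of `PromiseBQP` for `ajlGateSet` (Solovay–Kitaev, `PromiseBQPOver_eq_PromiseBQP`)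
and polynomial-time computability of the AJL entries. [cite: AharonovJonesLandau2009, Thm. 1.2 and §3] -/
theorem ajl_mem_PromiseBQPOver_ajlGateSet_iff (hSK : PromiseBQPOver_eq_PromiseBQP)
    (huniv : cliffordT.IsUniversal) (hcomp : ajlGateSet_polyTimeEntries) :
    ajl_mem_PromiseBQPOver_ajlGateSet ↔ ajl_jonesApproxProblem_mem_PromiseBQP :=
  ⟨fun h => ajl_jonesApproxProblem_mem_PromiseBQP_of_steps' hSK h huniv hcomp,
    ajl_mem_PromiseBQPOver_ajlGateSet_of_mem_PromiseBQP⟩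

end Literature.Computability.QuantumComplexity

end
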